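/-
Copyright (c) 2026 the pub-hodgecm-mathlib formalisation cell (harness21).  Prover seat hodgecm-mathlib-LH5-p04 (g5): LH4-plan (g6) WORDS #117∕#120 «CENSUS-M1 row #14», part II; 2026-09-02.
-/
import Literature.NumberTheory.Rogawski1990.TwoDeepRepresentativesTypeOneTrace            -- ★ part I (this seat): `twoDeepRep_typeOne_at_trace`
import HarnessLib

/-!
# LIFT rider (H2D), type (1), ½-FREE — part II: the neighbourhood form (Rogawski 1990 Prop. 4.9.1; Flicker 1998 §6)

Topic `NumberTheory/Rogawski1990`; namespace `Literature.NumberTheory.Rogawski1990`.  THEOREMS ONLY (no definition, no instance, no notation, no named fact, no `sorry`);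
count-neutral; kernel lane `--supports stmt-HodgeConjecture-24833`.  Cell `pub/hodgecm-mathlib` (D-0151), crux H413 = `stmt-HodgeConjecture-24833`, LH4-plan (g6) WORDS #117∕#120
(CENSUS-M1 row #14).  THE TWIN of ★ `TwoDeepRepresentativesTypeOne.exists_twoDeepRepresentative_of_finExplicitDelta_ne_zero_typeOne` (END fold v3.2 `stub_twoDeepRep_typeOne`
binders) with `h2 : IsUnit (2 : 𝒪_w)` DELETED and nothing else moved (the idle `_hμ _hμu _hμω` kept as the fold has them; conclusion verbatim; the neighbourhood `V` = integral
× `|tr g_w − 2| < |ϖ|⁶` × `|det g_w − 1| < |ϖ|⁶` × `|u_w − 1| < |ϖ|³` verbatim): **`exists_twoDeepRepresentative_of_finExplicitDelta_ne_zero_typeOne_trace`**, last line = part I's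
★ `twoDeepRep_typeOne_at_trace`.  HONEST READER LABEL: count-neutral; pays no organ, opens no road; HC_CM is proved only modulo the 7 printed citations (2 remaining named inputs:
hLiu418 = stmt-HodgeConjecture-24832, h413 = stmt-HodgeConjecture-24833) until rung 0 closes.

## References
* [Rogawski1990] J. D. Rogawski, *Automorphic Representations of Unitary Groups in Three Variables* (1990): §4.9 Prop. 4.9.1 (a) p. 55.
* [Flicker1998UnitaryFL] Y. Z. Flicker, *Elementary proof of the fundamental lemma for a unitary group*, Canad. J. Math. 50 (1998): §6 p. 97.
-/

set_option autoImplicit false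

noncomputable section

open NumberField IsDedekindDomain MeasureTheory Measure Topology Filter Matrix Polynomial
open Literature.NumberTheory.Rogawski1990 Literature.NumberTheory.Automorphic Literature.NumberTheory.GaloisRepresentations
open Literature.NumberTheory.Automorphic.UnitaryGroup Literature.NumberTheory.Automorphic.IntegralReduction
open scoped Matrix MatrixGroups ValuativeRel

namespace Literature.NumberTheory.Rogawski1990

set_option maxHeartbeats 400000 in
open scoped Classical in
/-- **LIFT RIDER (H2D), TYPE (1), ½-FREE** — END fold v3.2 `stub_twoDeepRep_typeOne` binders MINUS `h2 : IsUnit (2 : 𝒪_w)` + conclusion VERBATIM (the neighbourhood `V` verbatim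
and ★-twin `twoDeepRep_typeOne_at_trace`); twin of ★ `exists_twoDeepRepresentative_of_finExplicitDelta_ne_zero_typeOne` at EVERY residue characteristic.
[cite: Rogawski1990, §4.9 Prop. 4.9.1 (a) p. 55] [cite: Flicker1998UnitaryFL, §6 p. 97] -/
theorem exists_twoDeepRepresentative_of_finExplicitDelta_ne_zero_typeOne_trace
    (L : Type) [Field L] [NumberField L] [IsCMField L] (H' : Matrix (Fin 3) (Fin 3) L) (μ : HeckeCharacter L)
    {v : HeightOneSpectrum (𝓞 ↥(maximalRealSubfield L))}
    (hH' : (H'.map (cmConjRingHom L)).transpose = H') (w : PlacesOver L v)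
    (hw : IsCMField.complexConj L • w.1 = w.1) (hv : Algebra.IsUnramifiedIn (𝓞 L) v.asIdeal)
    (hH'w : IsUnit (placeForm H' w.1)) (hH'i : hH'w.unit ∈ glInt 3 (w.1.adicCompletion L))
    (_hμ : μ.IsUnramifiedAt w.1) (_hμu : μ.IsUnitary)
    (_hμω : ∀ x : ideleGroup ↥(maximalRealSubfield L), μ (AdeleRing.ideleBaseChange ↥(maximalRealSubfield L) L x) = quadraticHeckeCharCM L x) :
    ∃ V ∈ 𝓝 (1 : ((cmDatum L 2 (Matrix.of fun i j : Fin 2 => if i.val + j.val + 1 = 2 then (1 : L) else 0)).Local v × (cmDatum L 1 (Matrix.of fun i j : Fin 1 => if i.val + j.val + 1 = 1 then (1 : L) else 0)).Local v)), ∀ γH ∈ V, IsLocalGRegular L v γH →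
      (∃ x : w.1.adicCompletion L, (((γH.1.val : GL (Fin 2) (UnitaryGroup.LocalRing L v)).val.map
          (Pi.evalRingHom (fun w' : PlacesOver L v => w'.1.adicCompletion L) w)).charpoly).IsRoot x) →
      ¬ (∃ (y : ((cmDatum L 2 (Matrix.of fun i j : Fin 2 => if i.val + j.val + 1 = 2 then (1 : L) else 0)).Local v × (cmDatum L 1 (Matrix.of fun i j : Fin 1 => if i.val + j.val + 1 = 1 then (1 : L) else 0)).Local v)) (d' : Fin 2 → (UnitaryGroup.LocalRing L v)ˣ),
          glDiagonal 2 (UnitaryGroup.LocalRing L v) d' = ((y * γH * y⁻¹).1.val : GL (Fin 2) (UnitaryGroup.LocalRing L v))) →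
      (∀ cG : ConjClasses ((cmDatum L 3 H').Local v),
          ((finExplicitCollection L H' μ (finExplicitDelta_conj_left_all L H' μ) (finExplicitDelta_conj_right_all L H' μ)) v).Δ γH (Quotient.out cG) ≠ 0 →
          (∃ z ∈ cmLocalIntegralLevel L 3 H' v, ConjClasses.mk z = cG) →
          ∃ γ₀ : ((cmDatum L 3 H').Local v), ConjClasses.mk γ₀ = cG ∧ γ₀ ∈ cmLocalIntegralLevel L 3 H' v ∧
            (∀ a b, Valued.v (((toPlace v w (HeckeCharacter.uniformizer ↥(maximalRealSubfield L) v : v.adicCompletion ↥(maximalRealSubfield L))) ^ 2)⁻¹ *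
        ((((localNonsplitEquiv (IsCMField.complexConj L) H' (IsCMField.complexConj_ne_one L) w hw (γ₀) :
            ↥(unitaryGroupOfForm (galAdicCompletionMap (L := L) (IsCMField.complexConj L) hw) (placeForm H' w.1))) : GL (Fin 3) (w.1.adicCompletion L)) :
              Matrix (Fin 3) (Fin 3) (w.1.adicCompletion L)) a b - (1 : Matrix (Fin 3) (Fin 3) (w.1.adicCompletion L)) a b)) ≤ 1)) := by
  -- §1 THE NEIGHBOURHOOD `V`: integral (`γ_H ∈ K_H`) and 3-DEEP eigen-data (`|tr g_w − 2| < |ϖ|⁶`, `|det g_w − 1| < |ϖ|⁶`, `|u_w − 1| < |ϖ|³`)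
  have hcontg : Continuous fun γH : ((cmDatum L 2 (Matrix.of fun i j : Fin 2 => if i.val + j.val + 1 = 2 then (1 : L) else 0)).Local v ×
      (cmDatum L 1 (Matrix.of fun i j : Fin 1 => if i.val + j.val + 1 = 1 then (1 : L) else 0)).Local v) =>
      ((γH.1.val : GL (Fin 2) (UnitaryGroup.LocalRing L v)).val.map (Pi.evalRingHom (fun w' : PlacesOver L v => w'.1.adicCompletion L) w)) :=
    (Units.continuous_val.comp (continuous_subtype_val.comp continuous_fst)).matrix_map (continuous_apply w)
  have hcontu : Continuous fun γH : ((cmDatum L 2 (Matrix.of fun i j : Fin 2 => if i.val + j.val + 1 = 2 then (1 : L) else 0)).Local v ×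
      (cmDatum L 1 (Matrix.of fun i j : Fin 1 => if i.val + j.val + 1 = 1 then (1 : L) else 0)).Local v) => finGammaTwo L v γH w := by
    show Continuous fun γH : ((cmDatum L 2 (Matrix.of fun i j : Fin 2 => if i.val + j.val + 1 = 2 then (1 : L) else 0)).Local v ×
      (cmDatum L 1 (Matrix.of fun i j : Fin 1 => if i.val + j.val + 1 = 1 then (1 : L) else 0)).Local v) =>
      ((γH.2.val : GL (Fin 1) (UnitaryGroup.LocalRing L v)).val : Matrix (Fin 1) (Fin 1) (UnitaryGroup.LocalRing L v)) 0 0 w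
    exact (continuous_apply w).comp ((Units.continuous_val.comp (continuous_subtype_val.comp continuous_snd)).matrix_elem 0 0)
  set ϖw : w.1.adicCompletion L := (toPlace v w (HeckeCharacter.uniformizer ↥(maximalRealSubfield L) v : v.adicCompletion ↥(maximalRealSubfield L))) with hϖw
  have hball1 : ∀ c : w.1.adicCompletion L, {y : w.1.adicCompletion L | Valued.v (y - c) < 1} ∈ 𝓝 c := fun c =>
    (Valued.mem_nhds).2 ⟨1, fun y hy => by simpa using hy⟩
  have hball : ∀ (c : w.1.adicCompletion L) (m : ℕ), {y : w.1.adicCompletion L | Valued.v ((ϖw ^ m)⁻¹ * (y - c)) < 1} ∈ 𝓝 c := by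
    intro c m
    have hf : Continuous fun y : w.1.adicCompletion L => (ϖw ^ m)⁻¹ * (y - c) := continuous_const.mul (continuous_id.sub continuous_const)
    have h0 : {z : w.1.adicCompletion L | Valued.v (z - 0) < 1} ∈ 𝓝 ((ϖw ^ m)⁻¹ * (c - c)) := by rw [sub_self, mul_zero]; exact hball1 0
    have h := hf.continuousAt.preimage_mem_nhds h0
    simpa only [Set.preimage_setOf_eq, sub_zero] using h
  have h1g : (((1 : ((cmDatum L 2 (Matrix.of fun i j : Fin 2 => if i.val + j.val + 1 = 2 then (1 : L) else 0)).Local v ×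
      (cmDatum L 1 (Matrix.of fun i j : Fin 1 => if i.val + j.val + 1 = 1 then (1 : L) else 0)).Local v)).1.val : GL (Fin 2) (UnitaryGroup.LocalRing L v)).val.map
        (Pi.evalRingHom (fun w' : PlacesOver L v => w'.1.adicCompletion L) w)) = 1 := by
    have e : ((1 : ((cmDatum L 2 (Matrix.of fun i j : Fin 2 => if i.val + j.val + 1 = 2 then (1 : L) else 0)).Local v ×
      (cmDatum L 1 (Matrix.of fun i j : Fin 1 => if i.val + j.val + 1 = 1 then (1 : L) else 0)).Local v)).1.val : GL (Fin 2) (UnitaryGroup.LocalRing L v)).val = 1 := rfl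
    rw [e, Matrix.map_one _ (map_zero _) (map_one _)]
  have h1u : finGammaTwo L v (1 : ((cmDatum L 2 (Matrix.of fun i j : Fin 2 => if i.val + j.val + 1 = 2 then (1 : L) else 0)).Local v ×
      (cmDatum L 1 (Matrix.of fun i j : Fin 1 => if i.val + j.val + 1 = 1 then (1 : L) else 0)).Local v)) w = 1 := by
    show (((1 : ((cmDatum L 2 (Matrix.of fun i j : Fin 2 => if i.val + j.val + 1 = 2 then (1 : L) else 0)).Local v ×
      (cmDatum L 1 (Matrix.of fun i j : Fin 1 => if i.val + j.val + 1 = 1 then (1 : L) else 0)).Local v)).2.val : GL (Fin 1) (UnitaryGroup.LocalRing L v)).val :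
        Matrix (Fin 1) (Fin 1) (UnitaryGroup.LocalRing L v)) 0 0 w = 1
    have e : ((1 : ((cmDatum L 2 (Matrix.of fun i j : Fin 2 => if i.val + j.val + 1 = 2 then (1 : L) else 0)).Local v ×
      (cmDatum L 1 (Matrix.of fun i j : Fin 1 => if i.val + j.val + 1 = 1 then (1 : L) else 0)).Local v)).2.val : GL (Fin 1) (UnitaryGroup.LocalRing L v)).val = 1 := rfl
    rw [e, Matrix.one_apply_eq, Pi.one_apply]
  have hVK : (((cmLocalIntegralLevel L 2 (Matrix.of fun i j : Fin 2 => if i.val + j.val + 1 = 2 then (1 : L) else 0) v).prod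
      (cmLocalIntegralLevel L 1 (Matrix.of fun i j : Fin 1 => if i.val + j.val + 1 = 1 then (1 : L) else 0) v) : Subgroup ((cmDatum L 2 (Matrix.of fun i j : Fin 2 => if i.val + j.val + 1 = 2 then (1 : L) else 0)).Local v ×
      (cmDatum L 1 (Matrix.of fun i j : Fin 1 => if i.val + j.val + 1 = 1 then (1 : L) else 0)).Local v)) : Set ((cmDatum L 2 (Matrix.of fun i j : Fin 2 => if i.val + j.val + 1 = 2 then (1 : L) else 0)).Local v ×
      (cmDatum L 1 (Matrix.of fun i j : Fin 1 => if i.val + j.val + 1 = 1 then (1 : L) else 0)).Local v)) ∈ 𝓝 (1 : ((cmDatum L 2 (Matrix.of fun i j : Fin 2 => if i.val + j.val + 1 = 2 then (1 : L) else 0)).Local v ×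
      (cmDatum L 1 (Matrix.of fun i j : Fin 1 => if i.val + j.val + 1 = 1 then (1 : L) else 0)).Local v)) :=
    (isCompact_isOpen_cmLocalIntegralLevel_prod L 2 1 _ _ v).2.mem_nhds (Subgroup.one_mem _)
  have hVtr : {γH : ((cmDatum L 2 (Matrix.of fun i j : Fin 2 => if i.val + j.val + 1 = 2 then (1 : L) else 0)).Local v ×
      (cmDatum L 1 (Matrix.of fun i j : Fin 1 => if i.val + j.val + 1 = 1 then (1 : L) else 0)).Local v) |
      Valued.v ((ϖw ^ 6)⁻¹ * ((((γH.1.val : GL (Fin 2) (UnitaryGroup.LocalRing L v)).val.map (Pi.evalRingHom (fun w' : PlacesOver L v => w'.1.adicCompletion L) w)).trace - 2))) < 1} ∈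
        𝓝 (1 : ((cmDatum L 2 (Matrix.of fun i j : Fin 2 => if i.val + j.val + 1 = 2 then (1 : L) else 0)).Local v ×
      (cmDatum L 1 (Matrix.of fun i j : Fin 1 => if i.val + j.val + 1 = 1 then (1 : L) else 0)).Local v)) := by
    have h2 := hball (2 : w.1.adicCompletion L) 6
    have e : ((((1 : ((cmDatum L 2 (Matrix.of fun i j : Fin 2 => if i.val + j.val + 1 = 2 then (1 : L) else 0)).Local v ×
      (cmDatum L 1 (Matrix.of fun i j : Fin 1 => if i.val + j.val + 1 = 1 then (1 : L) else 0)).Local v)).1.val : GL (Fin 2) (UnitaryGroup.LocalRing L v)).val.map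
        (Pi.evalRingHom (fun w' : PlacesOver L v => w'.1.adicCompletion L) w)).trace) = 2 := by
      rw [h1g, Matrix.trace_one, Fintype.card_fin, Nat.cast_ofNat]
    have ht := hcontg.matrix_trace.continuousAt (x := 1)
    simp only [ContinuousAt] at ht
    rw [e] at ht
    exact ht h2
  have hVdet : {γH : ((cmDatum L 2 (Matrix.of fun i j : Fin 2 => if i.val + j.val + 1 = 2 then (1 : L) else 0)).Local v ×
      (cmDatum L 1 (Matrix.of fun i j : Fin 1 => if i.val + j.val + 1 = 1 then (1 : L) else 0)).Local v) |
      Valued.v ((ϖw ^ 6)⁻¹ * ((((γH.1.val : GL (Fin 2) (UnitaryGroup.LocalRing L v)).val.map (Pi.evalRingHom (fun w' : PlacesOver L v => w'.1.adicCompletion L) w)).det - 1))) < 1} ∈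
        𝓝 (1 : ((cmDatum L 2 (Matrix.of fun i j : Fin 2 => if i.val + j.val + 1 = 2 then (1 : L) else 0)).Local v ×
      (cmDatum L 1 (Matrix.of fun i j : Fin 1 => if i.val + j.val + 1 = 1 then (1 : L) else 0)).Local v)) := by
    have h1 := hball (1 : w.1.adicCompletion L) 6
    have e : ((((1 : ((cmDatum L 2 (Matrix.of fun i j : Fin 2 => if i.val + j.val + 1 = 2 then (1 : L) else 0)).Local v ×
      (cmDatum L 1 (Matrix.of fun i j : Fin 1 => if i.val + j.val + 1 = 1 then (1 : L) else 0)).Local v)).1.val : GL (Fin 2) (UnitaryGroup.LocalRing L v)).val.map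
        (Pi.evalRingHom (fun w' : PlacesOver L v => w'.1.adicCompletion L) w)).det) = 1 := by rw [h1g, Matrix.det_one]
    have ht := hcontg.matrix_det.continuousAt (x := 1)
    simp only [ContinuousAt] at ht
    rw [e] at ht
    exact ht h1
  have hVu : {γH : ((cmDatum L 2 (Matrix.of fun i j : Fin 2 => if i.val + j.val + 1 = 2 then (1 : L) else 0)).Local v ×
      (cmDatum L 1 (Matrix.of fun i j : Fin 1 => if i.val + j.val + 1 = 1 then (1 : L) else 0)).Local v) | Valued.v ((ϖw ^ 3)⁻¹ * (finGammaTwo L v γH w - 1)) < 1} ∈ 𝓝 (1 : ((cmDatum L 2 (Matrix.of fun i j : Fin 2 => if i.val + j.val + 1 = 2 then (1 : L) else 0)).Local v ×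
      (cmDatum L 1 (Matrix.of fun i j : Fin 1 => if i.val + j.val + 1 = 1 then (1 : L) else 0)).Local v)) := by
    have h1 := hball (1 : w.1.adicCompletion L) 3
    rw [← h1u] at h1
    exact hcontu.continuousAt.preimage_mem_nhds h1
  -- conversion `|(ϖ^m)⁻¹ x| < 1 ↔ |x| < |ϖ^m|`
  have hϖ1 : Valued.v ϖw = WithZero.exp (-1 : ℤ) :=
    Literature.NumberTheory.Automorphic.Liu2021.LemD1IndexedNonVacuityInertCofinite.valued_toPlace_uniformizer_of_isUnramifiedIn L v hv w
  have hconv : ∀ {x : w.1.adicCompletion L} {m : ℕ}, Valued.v ((ϖw ^ m)⁻¹ * x) < 1 → Valued.v x < Valued.v (ϖw ^ m) := by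
    intro x m h
    have hpos : 0 < Valued.v (ϖw ^ m) := by
      rw [map_pow, hϖ1]; exact pow_pos (zero_lt_iff.2 WithZero.exp_ne_zero) _
    rw [map_mul, map_inv₀, inv_mul_lt_iff₀ hpos, mul_one] at h
    exact h
  refine ⟨_, Filter.inter_mem (Filter.inter_mem (Filter.inter_mem hVK hVtr) hVdet) hVu, ?_⟩
  rintro γH ⟨⟨⟨hγK, htr⟩, hdet⟩, hub⟩ hreg hsplit hlev
  exact twoDeepRep_typeOne_at_trace L H' μ hH' w hw hv hH'w hH'i γH hγK (hconv htr) (hconv hdet) (hconv hub) hreg hsplit hlev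

end Literature.NumberTheory.Rogawski1990

end
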